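import Mathlib
import HarnessLib
import Summits.Ventures.LatticeQCDFlow.Exactness.SU2ResidualLocality
import Summits.Ventures.LatticeQCDFlow.Exactness.SU2ResidualExactForceCovering

/-!
# THE EXACT FORCE THROUGH THE LEARNED `SU(2)` RESIDUAL MEMBER IS LOCAL: with a differentiable conditioner of receptive radius `m` it reads the field only on the `(2(m+1)K+2)`-ball around the link (`K` = number of residual layers) — on EVERY torus, no size condition

HONEST FRAMING: exact (Metropolis-corrected) sampling algorithms for lattice gauge theory;
figures of merit are autocorrelation/cost numbers at stated couplings and volumes; no
continuum-physics claim.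

Venture `LatticeQCDFlow` (cell pub-lqcd), topic `Exactness`; FANOUT row 14 (`eng-flowhmc`, engine
`latflow.fthmc`, family B: FT-HMC through the LEARNED residual member `maps.residual_trained_scan` on
`SU(2)`, forces by autodiff of `S̃ = β S_W∘F − log J` along row 9's Pauli drift).  NEW WORK of the cell
over the tree (`GaugeFieldLocality`: neighbourhoods by integer representatives, `wilsonAction_cross`;
`GaugeFieldLocalityRadius`: `foldr_local_radius`, `foldr_off_radius`, `foldr_logDet_cross_radius`;
`SU2ResidualLocality`: under (ρL) of receptive radius `m` the residual layer is `(m+1)`-local and its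
density satisfies the `(m+1)`-cross identity;
`SU2ResidualExactForceCovering`: under (ρD) the learned member is differentiable along the Pauli drift;
`SU2WilsonFlowLOLocality` is the special case `ρ ≡ 1`); Mathlib's `HasFDerivAt.comp_hasDerivAt`,
`HasDerivAt.unique`; nothing is cited as a fact; no number.  Third file of the GEN-16 programme
(VOLUME-UNIFORMITY for the LEARNED members).  Vocabulary as in `GaugeFieldLocality` (VERBATIM, no
definition): `y` is `r`-near `x` iff `y = x + (zᵢ mod L)ᵢ` with integers `|zᵢ| ≤ r`; fields AGREE on
the `r`-ball at `x` iff they coincide at every edge whose base point is `r`-near `x`.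

The ONLY properties of the network that enter, as hypotheses on the weight family `ρf`:

  (ρL)  the weights at a link `e` read the field on the `(m+1)`-ball at `e.1` only (receptive radius
        `m`: the engine's frozen-plaquette features + a periodic CNN of kernel 3 and depth `m`), for
        every spec of the schedule;
  (ρD)  the weights are differentiable along differentiable link fields.

THE POINT (as for the LO member).  Along the one-link drift `t ↦ exp(t·u@l₀)·V` only the link `l₀`
moves.  If `V` and `W` agree on the `(2(m+1)K+2)`-ball at `l₀`, the cross identities give
`S̃(V_t) − S̃(W_t) = S̃(V) − S̃(W)` CONSTANT in `t`; both `t ↦ S̃(V_t)`, `t ↦ S̃(W_t)` are differentiable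
(ρD), hence the force components at `l₀` coincide.

* §1 **`ftAction_su2Residual_cross`** — under (ρL): `S̃(V') − S̃(W') = S̃(V) − S̃(W)` whenever `V', W'`
  agree on the `(2(m+1)K+2)`-ball at `x₀`, `V, W` too, and `V'` (`W'`) differs from `V` (`W`) at
  most at links based at `x₀`;
* §2 **`su2Residual_exactForce_local`** — under (ρL) + (ρD), for ANY schedule (positive booked
  densities), every `β, κ`: if `V`, `W` agree on the `(2(m+1)K+2)`-ball at `l₀.1` then
  `Φ_κ(V)_{l₀} = Φ_κ(W)_{l₀}`.

NOT CLAIMED: layers of different receptive radii (take the largest `m`); the sharp cone; that a given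
trained network meets (ρL)/(ρD); any number.
-/

noncomputable section

namespace Summit.Ventures.LatticeQCDFlow.Exactness

open Real Set MeasureTheory InnerProductGeometry WithLp NormedSpace
open Literature.MathematicalPhysics.QuantumFieldTheory
open Literature.MathematicalPhysics.QuantumFieldTheory.Balaban1983to89.B10Eq18SigmaSU2Haar (expPauli expPauli_zero)
open scoped Matrix Matrix.Norms.Operator

set_option backward.isDefEq.respectTransparency false

/-! ## §1 The cross identity for the FT action of the learned member -/

section Residual

variable {d L : ℕ} {X : Type*} [DecidableEq X] (χ : Site d L → X) {σ : Type*}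
  (μf : σ → Fin d) (bf : σ → X) (cf : σ → ℝ)
  (ρf : σ → GaugeConfig d L (Matrix.specialUnitaryGroup (Fin 2) ℂ) → Edge d L → Fin d → Fin 2 → ℝ) (m : ℕ) [NeZero L]

/-- **THE CROSS IDENTITY FOR `S̃ = β·S_W∘F − log J` OF THE LEARNED MEMBER** under (ρL) (ANY schedule, layers packaged VERBATIM as in
`exists_layers_su2Residual`, positive booked densities, `K = sched.length`, receptive radius `m`): if `V', W'` agree on the
`(2(m+1)K+2)`-ball at `x₀`, `V, W` too, and `V'` is `V` (resp. `W'` is `W`) away from the links based at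
`x₀`, then `S̃(V') − S̃(W') = S̃(V) − S̃(W)`. -/
theorem ftAction_su2Residual_cross (sched : List σ)
    (hρL : ∀ s ∈ sched, ∀ (U U' : GaugeConfig d L (Matrix.specialUnitaryGroup (Fin 2) ℂ)) (x : Site d L) (r : ℕ),
      (∀ e : Edge d L, (∃ z : Fin d → ℤ, (∀ i, |z i| ≤ (((r+m+1) : ℕ) : ℤ)) ∧ e.1 = x + fun i => ((z i : ℤ) : ZMod L)) → U e = U' e) →
      ∀ e : Edge d L, (∃ z : Fin d → ℤ, (∀ i, |z i| ≤ ((r : ℕ) : ℤ)) ∧ e.1 = x + fun i => ((z i : ℤ) : ZMod L)) → ∀ (ν : Fin d) (t : Fin 2), ρf s U e ν t = ρf s U' e ν t)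
    (layers : List ((GaugeConfig d L (Matrix.specialUnitaryGroup (Fin 2) ℂ) ≃ᵐ GaugeConfig d L (Matrix.specialUnitaryGroup (Fin 2) ℂ)) × (GaugeConfig d L (Matrix.specialUnitaryGroup (Fin 2) ℂ) → ℝ)))
    (hmap :
      layers.map (fun Ly => ((Ly.1 : GaugeConfig d L (Matrix.specialUnitaryGroup (Fin 2) ℂ) → GaugeConfig d L (Matrix.specialUnitaryGroup (Fin 2) ℂ)), Ly.2)) =
        sched.map (fun s =>
          ((fun (V : GaugeConfig d L (Matrix.specialUnitaryGroup (Fin 2) ℂ)) (e : Edge d L) =>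
        if e.2 = μf s ∧ χ e.1 = bf s then
          gaussUnit (geodesicKick (cf s) (∑ ν ∈ Finset.univ.erase e.2,
            (ρf s V e ν 0 • vecQuat (((V (Site.shift e.1 e.2, ν) * (V (Site.shift e.1 ν, e.2))⁻¹ * (V (e.1, ν))⁻¹)⁻¹ : Matrix.specialUnitaryGroup (Fin 2) ℂ) : Matrix (Fin 2) (Fin 2) ℂ) +
              ρf s V e ν 1 • vecQuat ((((V (Site.shift (e.1 - Pi.single ν 1) e.2, ν))⁻¹ * (V (e.1 - Pi.single ν 1, e.2))⁻¹ * V (e.1 - Pi.single ν 1, ν))⁻¹ : Matrix.specialUnitaryGroup (Fin 2) ℂ) : Matrix (Fin 2) (Fin 2) ℂ)))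
            (vecQuat ((V e : Matrix.specialUnitaryGroup (Fin 2) ℂ) : Matrix (Fin 2) (Fin 2) ℂ)))
        else V e),
           fun V : GaugeConfig d L (Matrix.specialUnitaryGroup (Fin 2) ℂ) => ∏ a : {e : Edge d L // e.2 = μf s ∧ χ e.1 = bf s},
          (if Real.sin (angle (∑ ν ∈ Finset.univ.erase a.1.2,
            (ρf s V a.1 ν 0 • vecQuat (((V (Site.shift a.1.1 a.1.2, ν) * (V (Site.shift a.1.1 ν, a.1.2))⁻¹ * (V (a.1.1, ν))⁻¹)⁻¹ : Matrix.specialUnitaryGroup (Fin 2) ℂ) : Matrix (Fin 2) (Fin 2) ℂ) +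
              ρf s V a.1 ν 1 • vecQuat ((((V (Site.shift (a.1.1 - Pi.single ν 1) a.1.2, ν))⁻¹ * (V (a.1.1 - Pi.single ν 1, a.1.2))⁻¹ * V (a.1.1 - Pi.single ν 1, ν))⁻¹ : Matrix.specialUnitaryGroup (Fin 2) ℂ) : Matrix (Fin 2) (Fin 2) ℂ))) (vecQuat ((V a.1 : Matrix.specialUnitaryGroup (Fin 2) ℂ) : Matrix (Fin 2) (Fin 2) ℂ))) = 0 then
            (1 - cf s * ‖(∑ ν ∈ Finset.univ.erase a.1.2,
            (ρf s V a.1 ν 0 • vecQuat (((V (Site.shift a.1.1 a.1.2, ν) * (V (Site.shift a.1.1 ν, a.1.2))⁻¹ * (V (a.1.1, ν))⁻¹)⁻¹ : Matrix.specialUnitaryGroup (Fin 2) ℂ) : Matrix (Fin 2) (Fin 2) ℂ) +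
              ρf s V a.1 ν 1 • vecQuat ((((V (Site.shift (a.1.1 - Pi.single ν 1) a.1.2, ν))⁻¹ * (V (a.1.1 - Pi.single ν 1, a.1.2))⁻¹ * V (a.1.1 - Pi.single ν 1, ν))⁻¹ : Matrix.specialUnitaryGroup (Fin 2) ℂ) : Matrix (Fin 2) (Fin 2) ℂ)))‖ * Real.cos (angle (∑ ν ∈ Finset.univ.erase a.1.2,
            (ρf s V a.1 ν 0 • vecQuat (((V (Site.shift a.1.1 a.1.2, ν) * (V (Site.shift a.1.1 ν, a.1.2))⁻¹ * (V (a.1.1, ν))⁻¹)⁻¹ : Matrix.specialUnitaryGroup (Fin 2) ℂ) : Matrix (Fin 2) (Fin 2) ℂ) +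
              ρf s V a.1 ν 1 • vecQuat ((((V (Site.shift (a.1.1 - Pi.single ν 1) a.1.2, ν))⁻¹ * (V (a.1.1 - Pi.single ν 1, a.1.2))⁻¹ * V (a.1.1 - Pi.single ν 1, ν))⁻¹ : Matrix.specialUnitaryGroup (Fin 2) ℂ) : Matrix (Fin 2) (Fin 2) ℂ))) (vecQuat ((V a.1 : Matrix.specialUnitaryGroup (Fin 2) ℂ) : Matrix (Fin 2) (Fin 2) ℂ)))) ^ 3
          else kickJac (cf s * ‖(∑ ν ∈ Finset.univ.erase a.1.2,
            (ρf s V a.1 ν 0 • vecQuat (((V (Site.shift a.1.1 a.1.2, ν) * (V (Site.shift a.1.1 ν, a.1.2))⁻¹ * (V (a.1.1, ν))⁻¹)⁻¹ : Matrix.specialUnitaryGroup (Fin 2) ℂ) : Matrix (Fin 2) (Fin 2) ℂ) +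
              ρf s V a.1 ν 1 • vecQuat ((((V (Site.shift (a.1.1 - Pi.single ν 1) a.1.2, ν))⁻¹ * (V (a.1.1 - Pi.single ν 1, a.1.2))⁻¹ * V (a.1.1 - Pi.single ν 1, ν))⁻¹ : Matrix.specialUnitaryGroup (Fin 2) ℂ) : Matrix (Fin 2) (Fin 2) ℂ)))‖) 2 (angle (∑ ν ∈ Finset.univ.erase a.1.2,
            (ρf s V a.1 ν 0 • vecQuat (((V (Site.shift a.1.1 a.1.2, ν) * (V (Site.shift a.1.1 ν, a.1.2))⁻¹ * (V (a.1.1, ν))⁻¹)⁻¹ : Matrix.specialUnitaryGroup (Fin 2) ℂ) : Matrix (Fin 2) (Fin 2) ℂ) +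
              ρf s V a.1 ν 1 • vecQuat ((((V (Site.shift (a.1.1 - Pi.single ν 1) a.1.2, ν))⁻¹ * (V (a.1.1 - Pi.single ν 1, a.1.2))⁻¹ * V (a.1.1 - Pi.single ν 1, ν))⁻¹ : Matrix.specialUnitaryGroup (Fin 2) ℂ) : Matrix (Fin 2) (Fin 2) ℂ))) (vecQuat ((V a.1 : Matrix.specialUnitaryGroup (Fin 2) ℂ) : Matrix (Fin 2) (Fin 2) ℂ)))))))
    (hpos : ∀ Ly ∈ layers, ∀ V, 0 < Ly.2 V) (β : ℝ)
    {V W V' W' : GaugeConfig d L (Matrix.specialUnitaryGroup (Fin 2) ℂ)} {x₀ : Site d L}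
    (h1 : (∀ e : Edge d L, (∃ z : Fin d → ℤ, (∀ i, |z i| ≤ (((0+2*(m+1)*sched.length+2) : ℕ) : ℤ)) ∧ e.1 = x₀ + fun i => ((z i : ℤ) : ZMod L)) → V' e = W' e))
    (h2 : (∀ e : Edge d L, (∃ z : Fin d → ℤ, (∀ i, |z i| ≤ (((0+2*(m+1)*sched.length+2) : ℕ) : ℤ)) ∧ e.1 = x₀ + fun i => ((z i : ℤ) : ZMod L)) → V e = W e))
    (h3 : (∀ e : Edge d L, ¬ (∃ z : Fin d → ℤ, (∀ i, |z i| ≤ ((0 : ℕ) : ℤ)) ∧ e.1 = x₀ + fun i => ((z i : ℤ) : ZMod L)) → V' e = V e)) (h4 : (∀ e : Edge d L, ¬ (∃ z : Fin d → ℤ, (∀ i, |z i| ≤ ((0 : ℕ) : ℤ)) ∧ e.1 = x₀ + fun i => ((z i : ℤ) : ZMod L)) → W' e = W e)) :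
    β * wilsonAction (Matrix.specialUnitaryGroup (Fin 2) ℂ).subtype ((layers.foldr (fun Ly (F : GaugeConfig d L (Matrix.specialUnitaryGroup (Fin 2) ℂ) ≃ᵐ GaugeConfig d L (Matrix.specialUnitaryGroup (Fin 2) ℂ)) => Ly.1.trans F) (MeasurableEquiv.refl (GaugeConfig d L (Matrix.specialUnitaryGroup (Fin 2) ℂ)))) V') - Real.log ((layers.foldr (fun Ly K => fun v => Ly.2 v * K (Ly.1 v)) (fun _ => (1 : ℝ))) V') - (β * wilsonAction (Matrix.specialUnitaryGroup (Fin 2) ℂ).subtype ((layers.foldr (fun Ly (F : GaugeConfig d L (Matrix.specialUnitaryGroup (Fin 2) ℂ) ≃ᵐ GaugeConfig d L (Matrix.specialUnitaryGroup (Fin 2) ℂ)) => Ly.1.trans F) (MeasurableEquiv.refl (GaugeConfig d L (Matrix.specialUnitaryGroup (Fin 2) ℂ)))) W') - Real.log ((layers.foldr (fun Ly K => fun v => Ly.2 v * K (Ly.1 v)) (fun _ => (1 : ℝ))) W')) =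
      β * wilsonAction (Matrix.specialUnitaryGroup (Fin 2) ℂ).subtype ((layers.foldr (fun Ly (F : GaugeConfig d L (Matrix.specialUnitaryGroup (Fin 2) ℂ) ≃ᵐ GaugeConfig d L (Matrix.specialUnitaryGroup (Fin 2) ℂ)) => Ly.1.trans F) (MeasurableEquiv.refl (GaugeConfig d L (Matrix.specialUnitaryGroup (Fin 2) ℂ)))) V) - Real.log ((layers.foldr (fun Ly K => fun v => Ly.2 v * K (Ly.1 v)) (fun _ => (1 : ℝ))) V) - (β * wilsonAction (Matrix.specialUnitaryGroup (Fin 2) ℂ).subtype ((layers.foldr (fun Ly (F : GaugeConfig d L (Matrix.specialUnitaryGroup (Fin 2) ℂ) ≃ᵐ GaugeConfig d L (Matrix.specialUnitaryGroup (Fin 2) ℂ)) => Ly.1.trans F) (MeasurableEquiv.refl (GaugeConfig d L (Matrix.specialUnitaryGroup (Fin 2) ℂ)))) W) - Real.log ((layers.foldr (fun Ly K => fun v => Ly.2 v * K (Ly.1 v)) (fun _ => (1 : ℝ))) W)) := by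
  obtain ⟨hloc, hJ⟩ := su2Residual_layers_local χ μf bf cf ρf m sched hρL layers hmap
  have hlen : layers.length = sched.length := length_eq_of_layers_map_eq layers sched _ _ hmap
  -- the Wilson part
  have hF1 := foldr_local_radius (m+1) layers hloc ((m+1) * sched.length + 2) V' W' x₀ (agree_of_radius_eq (by rw [hlen]; ring) h1)
  have hF2 := foldr_local_radius (m+1) layers hloc ((m+1) * sched.length + 2) V W x₀ (agree_of_radius_eq (by rw [hlen]; ring) h2)
  have hO3 := foldr_off_radius (m+1) layers hloc h3
  have hO4 := foldr_off_radius (m+1) layers hloc h4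
  have hS := wilsonAction_cross (Matrix.specialUnitaryGroup (Fin 2) ℂ).subtype (r := (m+1) * sched.length + 2)
    (s := 0 + (m+1) * layers.length) (by rw [hlen]; omega) hF1 hF2 hO3 hO4
  -- the density part
  have hJx := foldr_logDet_cross_radius (m+1) layers hloc hJ 0 2 V V' W W' x₀ (agree_of_radius_eq (by rw [hlen]) h1)
    (agree_of_radius_eq (by rw [hlen]) h2) h3 h4
  have hpV := foldr_logDet_pos layers hpos V
  have hpV' := foldr_logDet_pos layers hpos V'
  have hpW := foldr_logDet_pos layers hpos W
  have hpW' := foldr_logDet_pos layers hpos W'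
  have hlog : Real.log ((layers.foldr (fun Ly K => fun v => Ly.2 v * K (Ly.1 v)) (fun _ => (1 : ℝ))) V') - Real.log ((layers.foldr (fun Ly K => fun v => Ly.2 v * K (Ly.1 v)) (fun _ => (1 : ℝ))) W') =
      Real.log ((layers.foldr (fun Ly K => fun v => Ly.2 v * K (Ly.1 v)) (fun _ => (1 : ℝ))) V) - Real.log ((layers.foldr (fun Ly K => fun v => Ly.2 v * K (Ly.1 v)) (fun _ => (1 : ℝ))) W) := by
    have := congrArg Real.log hJx
    rw [Real.log_mul hpV'.ne' hpW.ne', Real.log_mul hpV.ne' hpW'.ne'] at this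
    linarith
  linear_combination β * hS - hlog

/-! ## §2 The exact force is local -/

/-- **THE EXACT FORCE THROUGH THE LEARNED `SU(2)` RESIDUAL MEMBER IS LOCAL** under (ρL) + (ρD).  ANY schedule (layers packaged VERBATIM
as in `exists_layers_su2Residual`, positive booked densities, `K = sched.length`), every `β, κ`, every
torus: if `V`, `W` agree on the `(2(m+1)K+2)`-ball at `l₀.1`, then `Φ_κ(V)_{l₀} = Φ_κ(W)_{l₀}`. -/
theorem su2Residual_exactForce_local (sched : List σ)
    (hρL : ∀ s ∈ sched, ∀ (U U' : GaugeConfig d L (Matrix.specialUnitaryGroup (Fin 2) ℂ)) (x : Site d L) (r : ℕ),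
      (∀ e : Edge d L, (∃ z : Fin d → ℤ, (∀ i, |z i| ≤ (((r+m+1) : ℕ) : ℤ)) ∧ e.1 = x + fun i => ((z i : ℤ) : ZMod L)) → U e = U' e) →
      ∀ e : Edge d L, (∃ z : Fin d → ℤ, (∀ i, |z i| ≤ ((r : ℕ) : ℤ)) ∧ e.1 = x + fun i => ((z i : ℤ) : ZMod L)) → ∀ (ν : Fin d) (t : Fin 2), ρf s U e ν t = ρf s U' e ν t)
    (hρD : ∀ (s : σ) (U : (Edge d L → EuclideanSpace ℝ (Fin 3)) → GaugeConfig d L (Matrix.specialUnitaryGroup (Fin 2) ℂ))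
      (p₀ : Edge d L → EuclideanSpace ℝ (Fin 3)),
      (∀ e : Edge d L, DifferentiableAt ℝ (fun p => ((U p e : (Matrix.specialUnitaryGroup (Fin 2) ℂ)) : Matrix (Fin 2) (Fin 2) ℂ)) p₀) →
      ∀ (e : Edge d L) (ν : Fin d) (b : Fin 2), DifferentiableAt ℝ (fun p => ρf s (U p) e ν b) p₀)
    (layers : List ((GaugeConfig d L (Matrix.specialUnitaryGroup (Fin 2) ℂ) ≃ᵐ GaugeConfig d L (Matrix.specialUnitaryGroup (Fin 2) ℂ)) × (GaugeConfig d L (Matrix.specialUnitaryGroup (Fin 2) ℂ) → ℝ)))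
    (hmap :
      layers.map (fun Ly => ((Ly.1 : GaugeConfig d L (Matrix.specialUnitaryGroup (Fin 2) ℂ) → GaugeConfig d L (Matrix.specialUnitaryGroup (Fin 2) ℂ)), Ly.2)) =
        sched.map (fun s =>
          ((fun (V : GaugeConfig d L (Matrix.specialUnitaryGroup (Fin 2) ℂ)) (e : Edge d L) =>
        if e.2 = μf s ∧ χ e.1 = bf s then
          gaussUnit (geodesicKick (cf s) (∑ ν ∈ Finset.univ.erase e.2,
            (ρf s V e ν 0 • vecQuat (((V (Site.shift e.1 e.2, ν) * (V (Site.shift e.1 ν, e.2))⁻¹ * (V (e.1, ν))⁻¹)⁻¹ : Matrix.specialUnitaryGroup (Fin 2) ℂ) : Matrix (Fin 2) (Fin 2) ℂ) +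
              ρf s V e ν 1 • vecQuat ((((V (Site.shift (e.1 - Pi.single ν 1) e.2, ν))⁻¹ * (V (e.1 - Pi.single ν 1, e.2))⁻¹ * V (e.1 - Pi.single ν 1, ν))⁻¹ : Matrix.specialUnitaryGroup (Fin 2) ℂ) : Matrix (Fin 2) (Fin 2) ℂ)))
            (vecQuat ((V e : Matrix.specialUnitaryGroup (Fin 2) ℂ) : Matrix (Fin 2) (Fin 2) ℂ)))
        else V e),
           fun V : GaugeConfig d L (Matrix.specialUnitaryGroup (Fin 2) ℂ) => ∏ a : {e : Edge d L // e.2 = μf s ∧ χ e.1 = bf s},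
          (if Real.sin (angle (∑ ν ∈ Finset.univ.erase a.1.2,
            (ρf s V a.1 ν 0 • vecQuat (((V (Site.shift a.1.1 a.1.2, ν) * (V (Site.shift a.1.1 ν, a.1.2))⁻¹ * (V (a.1.1, ν))⁻¹)⁻¹ : Matrix.specialUnitaryGroup (Fin 2) ℂ) : Matrix (Fin 2) (Fin 2) ℂ) +
              ρf s V a.1 ν 1 • vecQuat ((((V (Site.shift (a.1.1 - Pi.single ν 1) a.1.2, ν))⁻¹ * (V (a.1.1 - Pi.single ν 1, a.1.2))⁻¹ * V (a.1.1 - Pi.single ν 1, ν))⁻¹ : Matrix.specialUnitaryGroup (Fin 2) ℂ) : Matrix (Fin 2) (Fin 2) ℂ))) (vecQuat ((V a.1 : Matrix.specialUnitaryGroup (Fin 2) ℂ) : Matrix (Fin 2) (Fin 2) ℂ))) = 0 then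
            (1 - cf s * ‖(∑ ν ∈ Finset.univ.erase a.1.2,
            (ρf s V a.1 ν 0 • vecQuat (((V (Site.shift a.1.1 a.1.2, ν) * (V (Site.shift a.1.1 ν, a.1.2))⁻¹ * (V (a.1.1, ν))⁻¹)⁻¹ : Matrix.specialUnitaryGroup (Fin 2) ℂ) : Matrix (Fin 2) (Fin 2) ℂ) +
              ρf s V a.1 ν 1 • vecQuat ((((V (Site.shift (a.1.1 - Pi.single ν 1) a.1.2, ν))⁻¹ * (V (a.1.1 - Pi.single ν 1, a.1.2))⁻¹ * V (a.1.1 - Pi.single ν 1, ν))⁻¹ : Matrix.specialUnitaryGroup (Fin 2) ℂ) : Matrix (Fin 2) (Fin 2) ℂ)))‖ * Real.cos (angle (∑ ν ∈ Finset.univ.erase a.1.2,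
            (ρf s V a.1 ν 0 • vecQuat (((V (Site.shift a.1.1 a.1.2, ν) * (V (Site.shift a.1.1 ν, a.1.2))⁻¹ * (V (a.1.1, ν))⁻¹)⁻¹ : Matrix.specialUnitaryGroup (Fin 2) ℂ) : Matrix (Fin 2) (Fin 2) ℂ) +
              ρf s V a.1 ν 1 • vecQuat ((((V (Site.shift (a.1.1 - Pi.single ν 1) a.1.2, ν))⁻¹ * (V (a.1.1 - Pi.single ν 1, a.1.2))⁻¹ * V (a.1.1 - Pi.single ν 1, ν))⁻¹ : Matrix.specialUnitaryGroup (Fin 2) ℂ) : Matrix (Fin 2) (Fin 2) ℂ))) (vecQuat ((V a.1 : Matrix.specialUnitaryGroup (Fin 2) ℂ) : Matrix (Fin 2) (Fin 2) ℂ)))) ^ 3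
          else kickJac (cf s * ‖(∑ ν ∈ Finset.univ.erase a.1.2,
            (ρf s V a.1 ν 0 • vecQuat (((V (Site.shift a.1.1 a.1.2, ν) * (V (Site.shift a.1.1 ν, a.1.2))⁻¹ * (V (a.1.1, ν))⁻¹)⁻¹ : Matrix.specialUnitaryGroup (Fin 2) ℂ) : Matrix (Fin 2) (Fin 2) ℂ) +
              ρf s V a.1 ν 1 • vecQuat ((((V (Site.shift (a.1.1 - Pi.single ν 1) a.1.2, ν))⁻¹ * (V (a.1.1 - Pi.single ν 1, a.1.2))⁻¹ * V (a.1.1 - Pi.single ν 1, ν))⁻¹ : Matrix.specialUnitaryGroup (Fin 2) ℂ) : Matrix (Fin 2) (Fin 2) ℂ)))‖) 2 (angle (∑ ν ∈ Finset.univ.erase a.1.2,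
            (ρf s V a.1 ν 0 • vecQuat (((V (Site.shift a.1.1 a.1.2, ν) * (V (Site.shift a.1.1 ν, a.1.2))⁻¹ * (V (a.1.1, ν))⁻¹)⁻¹ : Matrix.specialUnitaryGroup (Fin 2) ℂ) : Matrix (Fin 2) (Fin 2) ℂ) +
              ρf s V a.1 ν 1 • vecQuat ((((V (Site.shift (a.1.1 - Pi.single ν 1) a.1.2, ν))⁻¹ * (V (a.1.1 - Pi.single ν 1, a.1.2))⁻¹ * V (a.1.1 - Pi.single ν 1, ν))⁻¹ : Matrix.specialUnitaryGroup (Fin 2) ℂ) : Matrix (Fin 2) (Fin 2) ℂ))) (vecQuat ((V a.1 : Matrix.specialUnitaryGroup (Fin 2) ℂ) : Matrix (Fin 2) (Fin 2) ℂ)))))))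
    (hpos : ∀ Ly ∈ layers, ∀ V, 0 < Ly.2 V) (β κ : ℝ)
    {V W : GaugeConfig d L (Matrix.specialUnitaryGroup (Fin 2) ℂ)} {l₀ : Edge d L}
    (h : (∀ e : Edge d L, (∃ z : Fin d → ℤ, (∀ i, |z i| ≤ (((0+2*(m+1)*sched.length+2) : ℕ) : ℤ)) ∧ e.1 = l₀.1 + fun i => ((z i : ℤ) : ZMod L)) → V e = W e)) :
    (fun (V : GaugeConfig d L (Matrix.specialUnitaryGroup (Fin 2) ℂ)) (l : Edge d L) => κ • WithLp.toLp 2 (fun i : Fin 3 =>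
        fderiv ℝ (fun a : Edge d L → EuclideanSpace ℝ (Fin 3) => β * wilsonAction (Matrix.specialUnitaryGroup (Fin 2) ℂ).subtype ((layers.foldr (fun Ly (F : GaugeConfig d L (Matrix.specialUnitaryGroup (Fin 2) ℂ) ≃ᵐ GaugeConfig d L (Matrix.specialUnitaryGroup (Fin 2) ℂ)) => Ly.1.trans F) (MeasurableEquiv.refl (GaugeConfig d L (Matrix.specialUnitaryGroup (Fin 2) ℂ)))) ((fun l : Edge d L => expPauli (a l)) * V)) - Real.log ((layers.foldr (fun Ly K => fun v => Ly.2 v * K (Ly.1 v)) (fun _ => (1 : ℝ))) ((fun l : Edge d L => expPauli (a l)) * V))) 0 (Pi.single l (EuclideanSpace.single i (1 : ℝ))))) V l₀ =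
      (fun (V : GaugeConfig d L (Matrix.specialUnitaryGroup (Fin 2) ℂ)) (l : Edge d L) => κ • WithLp.toLp 2 (fun i : Fin 3 =>
        fderiv ℝ (fun a : Edge d L → EuclideanSpace ℝ (Fin 3) => β * wilsonAction (Matrix.specialUnitaryGroup (Fin 2) ℂ).subtype ((layers.foldr (fun Ly (F : GaugeConfig d L (Matrix.specialUnitaryGroup (Fin 2) ℂ) ≃ᵐ GaugeConfig d L (Matrix.specialUnitaryGroup (Fin 2) ℂ)) => Ly.1.trans F) (MeasurableEquiv.refl (GaugeConfig d L (Matrix.specialUnitaryGroup (Fin 2) ℂ)))) ((fun l : Edge d L => expPauli (a l)) * V)) - Real.log ((layers.foldr (fun Ly K => fun v => Ly.2 v * K (Ly.1 v)) (fun _ => (1 : ℝ))) ((fun l : Edge d L => expPauli (a l)) * V))) 0 (Pi.single l (EuclideanSpace.single i (1 : ℝ))))) W l₀ := by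
  have key : ∀ u : EuclideanSpace ℝ (Fin 3),
      fderiv ℝ (fun a : Edge d L → EuclideanSpace ℝ (Fin 3) => β * wilsonAction (Matrix.specialUnitaryGroup (Fin 2) ℂ).subtype ((layers.foldr (fun Ly (F : GaugeConfig d L (Matrix.specialUnitaryGroup (Fin 2) ℂ) ≃ᵐ GaugeConfig d L (Matrix.specialUnitaryGroup (Fin 2) ℂ)) => Ly.1.trans F) (MeasurableEquiv.refl (GaugeConfig d L (Matrix.specialUnitaryGroup (Fin 2) ℂ)))) ((fun l : Edge d L => expPauli (a l)) * V)) - Real.log ((layers.foldr (fun Ly K => fun v => Ly.2 v * K (Ly.1 v)) (fun _ => (1 : ℝ))) ((fun l : Edge d L => expPauli (a l)) * V))) 0 (Pi.single l₀ u) =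
        fderiv ℝ (fun a : Edge d L → EuclideanSpace ℝ (Fin 3) => β * wilsonAction (Matrix.specialUnitaryGroup (Fin 2) ℂ).subtype ((layers.foldr (fun Ly (F : GaugeConfig d L (Matrix.specialUnitaryGroup (Fin 2) ℂ) ≃ᵐ GaugeConfig d L (Matrix.specialUnitaryGroup (Fin 2) ℂ)) => Ly.1.trans F) (MeasurableEquiv.refl (GaugeConfig d L (Matrix.specialUnitaryGroup (Fin 2) ℂ)))) ((fun l : Edge d L => expPauli (a l)) * W)) - Real.log ((layers.foldr (fun Ly K => fun v => Ly.2 v * K (Ly.1 v)) (fun _ => (1 : ℝ))) ((fun l : Edge d L => expPauli (a l)) * W))) 0 (Pi.single l₀ u) := by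
    intro u
    -- the one-link drift line and its derivative
    have hγ : HasDerivAt (fun t : ℝ => t • (Pi.single l₀ u : Edge d L → EuclideanSpace ℝ (Fin 3)))
        (Pi.single l₀ u : Edge d L → EuclideanSpace ℝ (Fin 3)) 0 := by
      simpa using (hasDerivAt_id (0 : ℝ)).smul_const (Pi.single l₀ u : Edge d L → EuclideanSpace ℝ (Fin 3))
    have h0 : (fun t : ℝ => t • (Pi.single l₀ u : Edge d L → EuclideanSpace ℝ (Fin 3))) 0 = 0 := zero_smul _ _
    -- only the link `l₀` moves; agreement on the ball persists
    have hoff : ∀ (t : ℝ) (U : GaugeConfig d L (Matrix.specialUnitaryGroup (Fin 2) ℂ)),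
        (∀ e : Edge d L, ¬ (∃ z : Fin d → ℤ, (∀ i, |z i| ≤ ((0 : ℕ) : ℤ)) ∧ e.1 = l₀.1 + fun i => ((z i : ℤ) : ZMod L)) → ((fun l : Edge d L => expPauli ((t • (Pi.single l₀ u : Edge d L → EuclideanSpace ℝ (Fin 3))) l)) * U) e = U e) := by
      intro t U e he
      have hne : e ≠ l₀ := fun heq => he (by subst heq; exact near_refl _ 0)
      simp only [Pi.mul_apply, Pi.smul_apply, Pi.single_eq_of_ne hne, smul_zero, expPauli_zero, one_mul]
    have hagr : ∀ t : ℝ, (∀ e : Edge d L, (∃ z : Fin d → ℤ, (∀ i, |z i| ≤ (((0+2*(m+1)*sched.length+2) : ℕ) : ℤ)) ∧ e.1 = l₀.1 + fun i => ((z i : ℤ) : ZMod L)) → ((fun l : Edge d L => expPauli ((t • (Pi.single l₀ u : Edge d L → EuclideanSpace ℝ (Fin 3))) l)) * V) e = ((fun l : Edge d L => expPauli ((t • (Pi.single l₀ u : Edge d L → EuclideanSpace ℝ (Fin 3))) l)) * W) e) := by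
      intro t e he
      simp only [Pi.mul_apply]
      rw [h e he]
    -- the difference is constant along the line
    have hconst : ∀ t : ℝ,
        (fun a : Edge d L → EuclideanSpace ℝ (Fin 3) => β * wilsonAction (Matrix.specialUnitaryGroup (Fin 2) ℂ).subtype ((layers.foldr (fun Ly (F : GaugeConfig d L (Matrix.specialUnitaryGroup (Fin 2) ℂ) ≃ᵐ GaugeConfig d L (Matrix.specialUnitaryGroup (Fin 2) ℂ)) => Ly.1.trans F) (MeasurableEquiv.refl (GaugeConfig d L (Matrix.specialUnitaryGroup (Fin 2) ℂ)))) ((fun l : Edge d L => expPauli (a l)) * V)) - Real.log ((layers.foldr (fun Ly K => fun v => Ly.2 v * K (Ly.1 v)) (fun _ => (1 : ℝ))) ((fun l : Edge d L => expPauli (a l)) * V))) (t • (Pi.single l₀ u : Edge d L → EuclideanSpace ℝ (Fin 3))) =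
          (fun a : Edge d L → EuclideanSpace ℝ (Fin 3) => β * wilsonAction (Matrix.specialUnitaryGroup (Fin 2) ℂ).subtype ((layers.foldr (fun Ly (F : GaugeConfig d L (Matrix.specialUnitaryGroup (Fin 2) ℂ) ≃ᵐ GaugeConfig d L (Matrix.specialUnitaryGroup (Fin 2) ℂ)) => Ly.1.trans F) (MeasurableEquiv.refl (GaugeConfig d L (Matrix.specialUnitaryGroup (Fin 2) ℂ)))) ((fun l : Edge d L => expPauli (a l)) * W)) - Real.log ((layers.foldr (fun Ly K => fun v => Ly.2 v * K (Ly.1 v)) (fun _ => (1 : ℝ))) ((fun l : Edge d L => expPauli (a l)) * W))) (t • (Pi.single l₀ u : Edge d L → EuclideanSpace ℝ (Fin 3))) +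
            (β * wilsonAction (Matrix.specialUnitaryGroup (Fin 2) ℂ).subtype ((layers.foldr (fun Ly (F : GaugeConfig d L (Matrix.specialUnitaryGroup (Fin 2) ℂ) ≃ᵐ GaugeConfig d L (Matrix.specialUnitaryGroup (Fin 2) ℂ)) => Ly.1.trans F) (MeasurableEquiv.refl (GaugeConfig d L (Matrix.specialUnitaryGroup (Fin 2) ℂ)))) V) - Real.log ((layers.foldr (fun Ly K => fun v => Ly.2 v * K (Ly.1 v)) (fun _ => (1 : ℝ))) V) - (β * wilsonAction (Matrix.specialUnitaryGroup (Fin 2) ℂ).subtype ((layers.foldr (fun Ly (F : GaugeConfig d L (Matrix.specialUnitaryGroup (Fin 2) ℂ) ≃ᵐ GaugeConfig d L (Matrix.specialUnitaryGroup (Fin 2) ℂ)) => Ly.1.trans F) (MeasurableEquiv.refl (GaugeConfig d L (Matrix.specialUnitaryGroup (Fin 2) ℂ)))) W) - Real.log ((layers.foldr (fun Ly K => fun v => Ly.2 v * K (Ly.1 v)) (fun _ => (1 : ℝ))) W))) := by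
      intro t
      have hx := ftAction_su2Residual_cross χ μf bf cf ρf m sched hρL layers hmap hpos β (hagr t) h (hoff t V) (hoff t W)
      beta_reduce
      linarith
    -- both are differentiable along the line; equal derivatives
    have hdV := differentiableAt_ftAction_su2Residual_pauliDrift χ μf bf cf ρf hρD sched layers hmap hpos β V 0
    have hdW := differentiableAt_ftAction_su2Residual_pauliDrift χ μf bf cf ρf hρD sched layers hmap hpos β W 0
    have hgV : HasFDerivAt (fun a : Edge d L → EuclideanSpace ℝ (Fin 3) => β * wilsonAction (Matrix.specialUnitaryGroup (Fin 2) ℂ).subtype ((layers.foldr (fun Ly (F : GaugeConfig d L (Matrix.specialUnitaryGroup (Fin 2) ℂ) ≃ᵐ GaugeConfig d L (Matrix.specialUnitaryGroup (Fin 2) ℂ)) => Ly.1.trans F) (MeasurableEquiv.refl (GaugeConfig d L (Matrix.specialUnitaryGroup (Fin 2) ℂ)))) ((fun l : Edge d L => expPauli (a l)) * V)) - Real.log ((layers.foldr (fun Ly K => fun v => Ly.2 v * K (Ly.1 v)) (fun _ => (1 : ℝ))) ((fun l : Edge d L => expPauli (a l)) * V))) (fderiv ℝ (fun a : Edge d L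 → EuclideanSpace ℝ (Fin 3) => β * wilsonAction (Matrix.specialUnitaryGroup (Fin 2) ℂ).subtype ((layers.foldr (fun Ly (F : GaugeConfig d L (Matrix.specialUnitaryGroup (Fin 2) ℂ) ≃ᵐ GaugeConfig d L (Matrix.specialUnitaryGroup (Fin 2) ℂ)) => Ly.1.trans F) (MeasurableEquiv.refl (GaugeConfig d L (Matrix.specialUnitaryGroup (Fin 2) ℂ)))) ((fun l : Edge d L => expPauli (a l)) * V)) - Real.log ((layers.foldr (fun Ly K => fun v => Ly.2 v * K (Ly.1 v)) (fun _ => (1 : ℝ))) ((fun l : Edge d L => expPauli (a l)) * V))) 0)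
        ((fun t : ℝ => t • (Pi.single l₀ u : Edge d L → EuclideanSpace ℝ (Fin 3))) 0) := by
      rw [h0]
      exact hdV.hasFDerivAt
    have hgW : HasFDerivAt (fun a : Edge d L → EuclideanSpace ℝ (Fin 3) => β * wilsonAction (Matrix.specialUnitaryGroup (Fin 2) ℂ).subtype ((layers.foldr (fun Ly (F : GaugeConfig d L (Matrix.specialUnitaryGroup (Fin 2) ℂ) ≃ᵐ GaugeConfig d L (Matrix.specialUnitaryGroup (Fin 2) ℂ)) => Ly.1.trans F) (MeasurableEquiv.refl (GaugeConfig d L (Matrix.specialUnitaryGroup (Fin 2) ℂ)))) ((fun l : Edge d L => expPauli (a l)) * W)) - Real.log ((layers.foldr (fun Ly K => fun v => Ly.2 v * K (Ly.1 v)) (fun _ => (1 : ℝ))) ((fun l : Edge d L => expPauli (a l)) * W))) (fderiv ℝ (fun a : Edge d L → EuclideanSpace ℝ (Fin 3) => β * wilsonAction (Matrix.specialUnitaryGroup (Fin 2) ℂ).subtype ((layers.foldr (fun Ly (F : GaugeConfig d L (Matrix.specialUnitaryGroup (Fin 2) ℂ) ≃ᵐ GaugeConfig d L (Matrix.specialUnitaryGroup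 (Fin 2) ℂ)) => Ly.1.trans F) (MeasurableEquiv.refl (GaugeConfig d L (Matrix.specialUnitaryGroup (Fin 2) ℂ)))) ((fun l : Edge d L => expPauli (a l)) * W)) - Real.log ((layers.foldr (fun Ly K => fun v => Ly.2 v * K (Ly.1 v)) (fun _ => (1 : ℝ))) ((fun l : Edge d L => expPauli (a l)) * W))) 0)
        ((fun t : ℝ => t • (Pi.single l₀ u : Edge d L → EuclideanSpace ℝ (Fin 3))) 0) := by
      rw [h0]
      exact hdW.hasFDerivAt
    have hcV := hgV.comp_hasDerivAt (0 : ℝ) hγ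
    have hcW := hgW.comp_hasDerivAt (0 : ℝ) hγ
    have hfun : ((fun a : Edge d L → EuclideanSpace ℝ (Fin 3) => β * wilsonAction (Matrix.specialUnitaryGroup (Fin 2) ℂ).subtype ((layers.foldr (fun Ly (F : GaugeConfig d L (Matrix.specialUnitaryGroup (Fin 2) ℂ) ≃ᵐ GaugeConfig d L (Matrix.specialUnitaryGroup (Fin 2) ℂ)) => Ly.1.trans F) (MeasurableEquiv.refl (GaugeConfig d L (Matrix.specialUnitaryGroup (Fin 2) ℂ)))) ((fun l : Edge d L => expPauli (a l)) * V)) - Real.log ((layers.foldr (fun Ly K => fun v => Ly.2 v * K (Ly.1 v)) (fun _ => (1 : ℝ))) ((fun l : Edge d L => expPauli (a l)) * V))) ∘ fun t : ℝ => t • (Pi.single l₀ u : Edge d L → EuclideanSpace ℝ (Fin 3))) =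
        fun t : ℝ => ((fun a : Edge d L → EuclideanSpace ℝ (Fin 3) => β * wilsonAction (Matrix.specialUnitaryGroup (Fin 2) ℂ).subtype ((layers.foldr (fun Ly (F : GaugeConfig d L (Matrix.specialUnitaryGroup (Fin 2) ℂ) ≃ᵐ GaugeConfig d L (Matrix.specialUnitaryGroup (Fin 2) ℂ)) => Ly.1.trans F) (MeasurableEquiv.refl (GaugeConfig d L (Matrix.specialUnitaryGroup (Fin 2) ℂ)))) ((fun l : Edge d L => expPauli (a l)) * W)) - Real.log ((layers.foldr (fun Ly K => fun v => Ly.2 v * K (Ly.1 v)) (fun _ => (1 : ℝ))) ((fun l : Edge d L => expPauli (a l)) * W))) ∘ fun t : ℝ => t • (Pi.single l₀ u : Edge d L → EuclideanSpace ℝ (Fin 3))) t +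
          (β * wilsonAction (Matrix.specialUnitaryGroup (Fin 2) ℂ).subtype ((layers.foldr (fun Ly (F : GaugeConfig d L (Matrix.specialUnitaryGroup (Fin 2) ℂ) ≃ᵐ GaugeConfig d L (Matrix.specialUnitaryGroup (Fin 2) ℂ)) => Ly.1.trans F) (MeasurableEquiv.refl (GaugeConfig d L (Matrix.specialUnitaryGroup (Fin 2) ℂ)))) V) - Real.log ((layers.foldr (fun Ly K => fun v => Ly.2 v * K (Ly.1 v)) (fun _ => (1 : ℝ))) V) - (β * wilsonAction (Matrix.specialUnitaryGroup (Fin 2) ℂ).subtype ((layers.foldr (fun Ly (F : GaugeConfig d L (Matrix.specialUnitaryGroup (Fin 2) ℂ) ≃ᵐ GaugeConfig d L (Matrix.specialUnitaryGroup (Fin 2) ℂ)) => Ly.1.trans F) (MeasurableEquiv.refl (GaugeConfig d L (Matrix.specialUnitaryGroup (Fin 2) ℂ)))) W) - Real.log ((layers.foldr (fun Ly K => fun v => Ly.2 v * K (Ly.1 v)) (fun _ => (1 : ℝ))) W))) := by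
      funext t
      exact hconst t
    rw [hfun] at hcV
    exact hcV.unique (hcW.add_const _)
  beta_reduce
  simp only [key]

end Residual

end Summit.Ventures.LatticeQCDFlow.Exactness
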